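import Literature.NumberTheory.Sieve.Maynard2016Prop94YPlusBound
import Literature.NumberTheory.Sieve.Maynard2016Prop94OneDimSum
import HarnessLib

/-!
# Maynard's Proposition 9.4: the `(k+1)`-dimensional quadratic form is `O(S₀ · S_A)`

Source: J. Maynard, *Dense clusters of primes in subsets*, Compositio Math. 152 (2016) =
arXiv:1405.2593 [Maynard2016DenseClusters], proof of Proposition 9.4 pp. 25–26.

The main term of the expanded majorant (P94-SPEC §1b–§1e) is the quadratic form
`Q⁺ = ∑_{d⁺,e⁺ ∈ box⁺} [cross-coprime] λ⁺_{d⁺} λ⁺_{e⁺}/∏_o [d⁺_o, e⁺_o]` of the coupled weights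
`λ⁺ = λ · λ̃` (`SelbergSieveOptionBox.lamProd`) on the `(k+1)`-dimensional box over `𝒟_k(𝓛)`.
By Möbius inversion on the box (`lamOfY_dualY`), the rearrangement `quadForm_eq_sum`, the local
bound `abs_quadForm_le` (`|ι| = k+1`), the split `sum_sq_yPlus_mul_prod_le` and the one-dimensional
evaluation `sum_oneDim_le`:
**`abs_quadFormPlus_le`** — `|Q⁺| ≤ 4¹³² · S₀(M,R₀) · S_A` with
`S_A = ∑_{g ∈ 𝒟_k(𝓛)} (y_g/φ_ω(g))² (∏_{p ∣ g}(1 + 2/(p-1)))² ∏_{p ∣ g}(p + 4k + 3)`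
(a `k`-dimensional sum of the shape treated by Lemma 8.4, cf. `FGKMT2018Prop91MainTermL84`).
Dividing by the normalisation `λ̃_1² = S₀²` of the majorant leaves `S_A/S₀ ≪ S_A (M/φ(M))/log R₀`
(`SelbergSieveOneDim.log_le_mul_S0`), Maynard's saving.

## References
* J. Maynard, *Dense clusters of primes in subsets*, Compositio Math. 152 (2016), proof of Prop. 9.4
  pp. 25–26 [Maynard2016DenseClusters].
-/

noncomputable section

open Finset
open scoped ArithmeticFunction.Moebius

namespace Literature.NumberTheory.Sieve.FGKMT2018

variable {k : ℕ}

/-- **`|Q⁺| ≤ 4¹³² S₀ S_A`**: the cross-coprime quadratic form of the coupled weights `λ⁺ = λ·λ̃` on the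
`(k+1)`-dimensional box (levels `⌊R⌋,…,⌊R⌋,R₀`; moduli `idxMod 𝓛 B R` and `M`, every prime `∤ M`
exceeding `2k²`) is bounded by `4¹³² · S₀(M,R₀) · ∑_{g ∈ 𝒟_k}(y_g/φ_ω(g))² E(g)² ∏_{p ∣ g}(p+4k+3)`.
[cite: Maynard2016DenseClusters, proof of Prop. 9.4 pp. 25–26 (displays (9.9)–(9.11))] -/
theorem abs_quadFormPlus_le (hk : 2 ≤ k) {L : Fin k → ℤ × ℤ} (hadm : FormsAdmissible L) {B : ℕ}
    {R : ℝ} (hR : 1 ≤ R)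
    (hpref : 0 ≤ ((wCut k B * B : ℕ) : ℝ) ^ k / (Nat.totient (wCut k B * B) : ℝ) ^ k *
      singSeriesExcl L (wCut k B * B))
    {M : ℕ} (hM : ∀ p : ℕ, p.Prime → ¬ p ∣ M → 2 * k ^ 2 < p) (R₀ : ℝ) :
    |∑ d ∈ SelbergBox.gBox (SelbergBox.optN (fun _ : Fin k => ⌊R⌋₊) R₀)
        (SelbergBox.optW (idxMod L B R) M),
      ∑ e ∈ SelbergBox.gBox (SelbergBox.optN (fun _ : Fin k => ⌊R⌋₊) R₀)
        (SelbergBox.optW (idxMod L B R) M),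
        (if ∀ i l, i ≠ l → (d i * e i).Coprime (d l * e l) then
          SelbergBox.lamProd (fun _ : Fin k => ⌊R⌋₊) (idxMod L B R)
              (fun g => yVar L B R (MaynardDense.F k) g / phiOmega L (∏ i, g i)) M R₀ d *
            SelbergBox.lamProd (fun _ : Fin k => ⌊R⌋₊) (idxMod L B R)
              (fun g => yVar L B R (MaynardDense.F k) g / phiOmega L (∏ i, g i)) M R₀ e /
            ∏ o, ((Nat.lcm (d o) (e o) : ℕ) : ℝ) else 0)| ≤
      (4 : ℝ) ^ 132 * SelbergBox.S0 M R₀ *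
        ∑ g ∈ dkBox L B R,
          (yVar L B R (MaynardDense.F k) g / phiOmega L (∏ i, g i)) ^ 2 *
            (∏ p ∈ (∏ j, g j).primeFactors, (1 + 2 / ((p : ℝ) - 1))) ^ 2 *
            ∏ p ∈ (∏ j, g j).primeFactors, ((p : ℝ) + 4 * ((k : ℝ) + 1) - 1) := by
  classical
  set Np := SelbergBox.optN (fun _ : Fin k => ⌊R⌋₊) R₀ with hNp
  set Wp := SelbergBox.optW (idxMod L B R) M with hWp
  set Λ : (Option (Fin k) → ℕ) → ℝ := SelbergBox.lamProd (fun _ : Fin k => ⌊R⌋₊) (idxMod L B R)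
    (fun g => yVar L B R (MaynardDense.F k) g / phiOmega L (∏ i, g i)) M R₀ with hΛ
  set Yp : (Option (Fin k) → ℕ) → ℝ := SelbergBox.dualY Np Wp Λ with hYp
  set SA : ℝ := ∑ g ∈ dkBox L B R,
    (yVar L B R (MaynardDense.F k) g / phiOmega L (∏ i, g i)) ^ 2 *
      (∏ p ∈ (∏ j, g j).primeFactors, (1 + 2 / ((p : ℝ) - 1))) ^ 2 *
      ∏ p ∈ (∏ j, g j).primeFactors, ((p : ℝ) + 4 * ((k : ℝ) + 1) - 1) with hSA
  -- Step 1: `λ⁺ = lamOfY y⁺` on the box (Möbius inversion), so the form is the generic one.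
  have h1 : ∑ d ∈ SelbergBox.gBox Np Wp, ∑ e ∈ SelbergBox.gBox Np Wp,
      (if ∀ i l, i ≠ l → (d i * e i).Coprime (d l * e l) then
        Λ d * Λ e / ∏ o, ((Nat.lcm (d o) (e o) : ℕ) : ℝ) else 0) =
      ∑ d ∈ SelbergBox.gBox Np Wp, ∑ e ∈ SelbergBox.gBox Np Wp,
      (if ∀ i l, i ≠ l → (d i * e i).Coprime (d l * e l) then
        SelbergBox.lamOfY Np Wp Yp d * SelbergBox.lamOfY Np Wp Yp e /
          ∏ o, ((Nat.lcm (d o) (e o) : ℕ) : ℝ) else 0) := by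
    refine Finset.sum_congr rfl fun d hd => Finset.sum_congr rfl fun e he => ?_
    rw [SelbergBox.lamOfY_dualY Np Wp Λ hd, SelbergBox.lamOfY_dualY Np Wp Λ he]
  -- Step 2: rearrangement + local bound.
  have h2 := SelbergBox.quadForm_eq_sum Np Wp Yp
  have h3 := SelbergBox.abs_quadForm_le Np Wp Yp
  have hcard : ((Fintype.card (Option (Fin k)) : ℕ) : ℝ) = (k : ℝ) + 1 := by
    simp [Fintype.card_option]
  simp only [hcard] at h3
  -- Step 3: the diagonal sum splits and the one-dimensional factor is `≤ 4¹⁰⁸ S₀`.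
  have h4 := sum_sq_yPlus_mul_prod_le hk hadm hR hpref M R₀
  have h5 := sum_oneDim_le hk hM R₀
  have hSA0 : 0 ≤ SA := Finset.sum_nonneg fun g _ =>
    mul_nonneg (mul_nonneg (sq_nonneg _) (sq_nonneg _)) (Finset.prod_nonneg fun p _ => by
      have h1' : (0 : ℝ) ≤ p := Nat.cast_nonneg p
      have h2' : (0 : ℝ) ≤ k := Nat.cast_nonneg k
      linarith)
  rw [h1, h2]
  refine h3.trans (h4.trans ?_)
  calc (4 : ℝ) ^ 24 * SA * _ ≤ (4 : ℝ) ^ 24 * SA * ((4 : ℝ) ^ 108 * SelbergBox.S0 M R₀) :=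
        mul_le_mul_of_nonneg_left h5 (by positivity)
    _ = (4 : ℝ) ^ 132 * SelbergBox.S0 M R₀ * SA := by ring

end Literature.NumberTheory.Sieve.FGKMT2018
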